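import Summits.HodgeConjecture.HodgeConjecture.Theorems.Ring2WeilCoverageCyclotomicPrincipalObstruction
import Summits.HodgeConjecture.HodgeConjecture.Theorems.Ring2WeilCoverageRealQuadraticUnitNorm
import HarnessLib

/-!
# Weil-type family coverage — the census's ℚ(√−11) tenfold NO verdicts UNCONDITIONALLY: no `ι`-compatible
# principal polarisation on `ℂ^Φ/Φ(ℤ[ζ₃₃])`, `ℂ^Φ/Φ(ℤ[ζ₄₄])` for `ℚ(√−11)`-balanced `Φ`

research route conditional on HC_CM; not a corollary; Q11.4-sentence-2 already refuted in dim ≥ 3.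

Ring 2, WEIL-TYPE FAMILY-COVERAGE CENSUS (`HOME/WEIL-FAMILY-COVERAGE.md` `## b01`, blocks b01.23 (D) / b01.24 (A)
/ b01.28 «(5, ℚ(√−11), 1) carries NO principally polarised simple CM point with CM by `ℤ[ζ₃₃]` or `ℤ[ζ₄₄]`
(parity obstruction)»; owner ring2-b01), part 10 of the `Ring2WeilCoverage*` series — the `g = 10` companion of
part 9 (`…CyclotomicUnconditional`, levels `21, 28, 36`): the hypothesis `hN` (THEOREM L (i)) of part 7's NO
theorem DISCHARGED at `M = 33, 44` by part 8's route (`ℚ(ζ₃₃)⁺ ⊇ ℚ(√33)`, `ℚ(ζ₄₄)⁺ ⊇ ℚ(√11)`; primes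
`3 ∣ 33`, `11 ∣ 11`, both `≡ 3 (mod 4)`):

* §1 the Gauss period of `11`: `sq_gaussEleven` — `(1 + 2(η + η³ + η⁴ + η⁵ + η⁹))² = −11` for a primitive
  `11`-th root `η` (quadratic residues `{1,3,4,5,9}`) — and `complexConj_gaussEleven` (conjugation negates it);
  `sq_sqrtThirtyThree` / `complexConj_sqrtThirtyThree` (`θ₀ = (1 + 2ζ¹¹)·(Gauss period of ζ³)`, `θ₀² = 33`,
  real), `sq_sqrtEleven` / `complexConj_sqrtEleven` (`θ₀ = ζ¹¹·(Gauss period of ζ⁴)`, `θ₀² = 11`, real); hence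
  `norm_realUnits_pos_thirtyThree` / `…_fortyFour`: units of `𝓞(ℚ(ζ₃₃)⁺)`, `𝓞(ℚ(ζ₄₄)⁺)` have norm `+1`.
* §2 **THE TWO CENSUS ROWS, HYPOTHESIS-FREE**: `not_exists_principal_thirtyThree`
  (`N_{√−11} = {2,7,8,10,13,17,19,28,29,32}`, `n₋ = 5`) and `not_exists_principal_fortyFour`
  (`N_{√−11} = {7,13,17,19,21,29,35,39,41,43}`, `n₋ = 5`): for any CM type `Φ` of `ℚ(ζ_M)` balanced for `N_K`,
  `¬ ∃ ζ′, ζ′^ρ = −ζ′ ∧ (∀ φ ∈ Φ, Im φ(ζ′) > 0) ∧ CMTypeLattice.IsOfType 1 ζ′ ⊤`.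

HONEST FRAMING as part 9: the sets `N_K` are the census's «residues `t` with `t mod 11` a non-residue» (acting
as conjugation on `√−11`, the Gauss period) — an identification stated here, the theorems holding for the
displayed finite sets as such; statements about Shimura's divisors of principal type on the principal CM torus;
nothing about Hodge classes, `W_K`, general members or HC; `HC_CM` is used nowhere.  No `def`, no named fact, no
`sorry`.

References: [cite: Shimura1998, §14.3 Prop. 4–5, pp. 103–104]; census b01.23 (D) / b01.28 (seat-derived).
-/

noncomputable section

open Module NumberField Polynomial
open scoped nonZeroDivisors

namespace Summit.HodgeConjecture.Ring2WeilCoverage.CyclotomicUnconditionalSqrtNegEleven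

open Literature.AlgebraicGeometry.Motives (CMType)
open Literature.AlgebraicGeometry.HodgeTheory (IsCMTypeSet)
open Literature.NumberTheory.ComplexMultiplication
open Summit.HodgeConjecture.Ring2WeilCoverage.CyclotomicPrincipalObstruction
open Summit.HodgeConjecture.Ring2WeilCoverage.RealQuadraticUnitNorm

variable {K : Type} [Field K] [NumberField K] [IsCMField K]

/-! ### §1 The Gauss period of `11`; `√33 ∈ ℚ(ζ₃₃)⁺`, `√11 ∈ ℚ(ζ₄₄)⁺` -/

omit [NumberField K] [IsCMField K] in
/-- **The Gauss period of `11`**: `(1 + 2(η + η³ + η⁴ + η⁵ + η⁹))² = −11` for a primitive `11`-th root of unity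
`η` (`{1,3,4,5,9}` = the quadratic residues mod `11`; `g² = 2g + 3g′`, `g + g′ = −1`).
research route conditional on HC_CM; not a corollary; Q11.4-sentence-2 already refuted in dim ≥ 3. [folklore] -/
theorem sq_gaussEleven {η : K} (hη : IsPrimitiveRoot η 11) :
    (1 + 2 * (η + η ^ 3 + η ^ 4 + η ^ 5 + η ^ 9)) ^ 2 = (-11 : K) := by
  have h11 := hη.geom_sum_eq_zero (by norm_num : 1 < 11)
  simp only [Finset.sum_range_succ, Finset.sum_range_zero, zero_add, pow_zero, pow_one] at h11
  have hη11 : η ^ 11 = 1 := hη.pow_eq_one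
  linear_combination (12 : K) * h11 + (8 * η + 8 * η ^ 2 + 8 * η ^ 3 + 4 * η ^ 7) * hη11

/-- **Conjugation negates the Gauss period of `11`** (`η ↦ η⁻¹ = η¹⁰` maps residues to non-residues,
`−1` being a non-residue mod `11`).
research route conditional on HC_CM; not a corollary; Q11.4-sentence-2 already refuted in dim ≥ 3. [folklore] -/
theorem complexConj_gaussEleven {η : K} (hη : IsPrimitiveRoot η 11) :
    IsCMField.complexConj K (1 + 2 * (η + η ^ 3 + η ^ 4 + η ^ 5 + η ^ 9)) =
      -(1 + 2 * (η + η ^ 3 + η ^ 4 + η ^ 5 + η ^ 9)) := by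
  have h11 := hη.geom_sum_eq_zero (by norm_num : 1 < 11)
  simp only [Finset.sum_range_succ, Finset.sum_range_zero, zero_add, pow_zero, pow_one] at h11
  have hη11 : η ^ 11 = 1 := hη.pow_eq_one
  have hc : IsCMField.complexConj K η = η ^ 10 := by
    rw [complexConj_eq_inv_of_pow_eq_one (by norm_num) hη11]
    exact inv_eq_of_mul_eq_one_right (by linear_combination hη11)
  simp only [map_mul, map_add, map_one, map_ofNat, map_pow, hc]
  linear_combination (2 : K) * h11 + (2 * η ^ 2 + 2 * η ^ 6 + 2 * η ^ 7 + 2 * η ^ 8 + 2 * η ^ 13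
    + 2 * η ^ 17 + 2 * η ^ 18 + 2 * η ^ 19 + 2 * η ^ 24 + 2 * η ^ 28 + 2 * η ^ 29 + 2 * η ^ 35 + 2 * η ^ 39
    + 2 * η ^ 46 + 2 * η ^ 57 + 2 * η ^ 68 + 2 * η ^ 79) * hη11

omit [NumberField K] [IsCMField K] in
/-- **`√33 ∈ ℚ(ζ₃₃)`**: `θ₀ = (1 + 2ζ¹¹)·(1 + 2(η + η³ + η⁴ + η⁵ + η⁹))`, `η = ζ³`, has `θ₀² = (−3)(−11) = 33`.
research route conditional on HC_CM; not a corollary; Q11.4-sentence-2 already refuted in dim ≥ 3. [folklore] -/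
theorem sq_sqrtThirtyThree {ζ : K} (hζ : IsPrimitiveRoot ζ 33) :
    ((1 + 2 * ζ ^ 11) * (1 + 2 * (ζ ^ 3 + (ζ ^ 3) ^ 3 + (ζ ^ 3) ^ 4 + (ζ ^ 3) ^ 5 + (ζ ^ 3) ^ 9))) ^ 2 =
      (33 : K) := by
  have hω : IsPrimitiveRoot (ζ ^ 11) 3 := hζ.pow (by norm_num) (by norm_num)
  have hη : IsPrimitiveRoot (ζ ^ 3) 11 := hζ.pow (by norm_num) (by norm_num)
  have h3 := hω.geom_sum_eq_zero (by norm_num : 1 < 3)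
  simp only [Finset.sum_range_succ, Finset.sum_range_zero, zero_add, pow_zero, pow_one] at h3
  have hA : (1 + 2 * ζ ^ 11) ^ 2 = -3 := by linear_combination (4 : K) * h3
  rw [mul_pow, hA, sq_gaussEleven hη]; norm_num

/-- **`θ₀ = (1 + 2ζ¹¹)·(Gauss period of ζ³)` is real** (conjugation negates both factors).
research route conditional on HC_CM; not a corollary; Q11.4-sentence-2 already refuted in dim ≥ 3. [folklore] -/
theorem complexConj_sqrtThirtyThree {ζ : K} (hζ : IsPrimitiveRoot ζ 33) :
    IsCMField.complexConj K ((1 + 2 * ζ ^ 11) * (1 + 2 * (ζ ^ 3 + (ζ ^ 3) ^ 3 + (ζ ^ 3) ^ 4 + (ζ ^ 3) ^ 5 +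
      (ζ ^ 3) ^ 9))) =
      (1 + 2 * ζ ^ 11) * (1 + 2 * (ζ ^ 3 + (ζ ^ 3) ^ 3 + (ζ ^ 3) ^ 4 + (ζ ^ 3) ^ 5 + (ζ ^ 3) ^ 9)) := by
  have hω : IsPrimitiveRoot (ζ ^ 11) 3 := hζ.pow (by norm_num) (by norm_num)
  have hη : IsPrimitiveRoot (ζ ^ 3) 11 := hζ.pow (by norm_num) (by norm_num)
  have h3 := hω.geom_sum_eq_zero (by norm_num : 1 < 3)
  simp only [Finset.sum_range_succ, Finset.sum_range_zero, zero_add, pow_zero, pow_one] at h3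
  have hω3 : (ζ ^ 11) ^ 3 = 1 := hω.pow_eq_one
  have hcω : IsCMField.complexConj K (ζ ^ 11) = (ζ ^ 11) ^ 2 := by
    rw [complexConj_eq_inv_of_pow_eq_one (by norm_num) hω3]
    exact inv_eq_of_mul_eq_one_right (by linear_combination hω3)
  have hA' : IsCMField.complexConj K (1 + 2 * ζ ^ 11) = -(1 + 2 * ζ ^ 11) := by
    rw [map_add, map_one, map_mul, map_ofNat, hcω]; linear_combination (2 : K) * h3
  rw [map_mul, hA', complexConj_gaussEleven hη]; ring

omit [NumberField K] [IsCMField K] in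
/-- **`√11 ∈ ℚ(ζ₄₄)`**: `θ₀ = ζ¹¹·(1 + 2(η + η³ + η⁴ + η⁵ + η⁹))`, `η = ζ⁴`, has `θ₀² = (−1)(−11) = 11`.
research route conditional on HC_CM; not a corollary; Q11.4-sentence-2 already refuted in dim ≥ 3. [folklore] -/
theorem sq_sqrtEleven {ζ : K} (hζ : IsPrimitiveRoot ζ 44) :
    (ζ ^ 11 * (1 + 2 * (ζ ^ 4 + (ζ ^ 4) ^ 3 + (ζ ^ 4) ^ 4 + (ζ ^ 4) ^ 5 + (ζ ^ 4) ^ 9))) ^ 2 = (11 : K) := by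
  have hi : IsPrimitiveRoot (ζ ^ 11) 4 := hζ.pow (by norm_num) (by norm_num)
  have hη : IsPrimitiveRoot (ζ ^ 4) 11 := hζ.pow (by norm_num) (by norm_num)
  have hi2 : (ζ ^ 11) ^ 2 = -1 := by
    have := hi.pow (by norm_num : 0 < 4) (show 4 = 2 * 2 by norm_num)
    rw [← pow_mul] at this ⊢
    simpa using this.eq_neg_one_of_two_right
  rw [mul_pow, hi2, sq_gaussEleven hη]; norm_num

/-- **`θ₀ = ζ¹¹·(Gauss period of ζ⁴)` is real** (conjugation negates `ζ¹¹ = i` and the Gauss period).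
research route conditional on HC_CM; not a corollary; Q11.4-sentence-2 already refuted in dim ≥ 3. [folklore] -/
theorem complexConj_sqrtEleven {ζ : K} (hζ : IsPrimitiveRoot ζ 44) :
    IsCMField.complexConj K (ζ ^ 11 * (1 + 2 * (ζ ^ 4 + (ζ ^ 4) ^ 3 + (ζ ^ 4) ^ 4 + (ζ ^ 4) ^ 5 +
      (ζ ^ 4) ^ 9))) =
      ζ ^ 11 * (1 + 2 * (ζ ^ 4 + (ζ ^ 4) ^ 3 + (ζ ^ 4) ^ 4 + (ζ ^ 4) ^ 5 + (ζ ^ 4) ^ 9)) := by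
  have hi : IsPrimitiveRoot (ζ ^ 11) 4 := hζ.pow (by norm_num) (by norm_num)
  have hη : IsPrimitiveRoot (ζ ^ 4) 11 := hζ.pow (by norm_num) (by norm_num)
  have hi4 : (ζ ^ 11) ^ 4 = 1 := hi.pow_eq_one
  have hi2 : (ζ ^ 11) ^ 2 = -1 := by
    have := hi.pow (by norm_num : 0 < 4) (show 4 = 2 * 2 by norm_num)
    rw [← pow_mul] at this ⊢
    simpa using this.eq_neg_one_of_two_right
  have hci : IsCMField.complexConj K (ζ ^ 11) = -(ζ ^ 11) := by
    rw [complexConj_eq_inv_of_pow_eq_one (by norm_num) hi4]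
    refine inv_eq_of_mul_eq_one_right ?_
    linear_combination (-1 : K) * hi2
  rw [map_mul, hci, complexConj_gaussEleven hη]; ring

/-- **THEOREM L (i) at `M = 33`, proved**: every unit of `𝓞(ℚ(ζ₃₃)⁺)` has positive norm (`ℚ(ζ₃₃)⁺ ∋ √33`,
`3 ∣ 33`, `9 ∤ 33`).
research route conditional on HC_CM; not a corollary; Q11.4-sentence-2 already refuted in dim ≥ 3. [folklore] -/
theorem norm_realUnits_pos_thirtyThree [IsCyclotomicExtension {33} ℚ K] {ζ : K} (hζ : IsPrimitiveRoot ζ 33)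
    (v : (𝓞 (maximalRealSubfield K))ˣ) :
    0 < Algebra.norm ℚ (((v : 𝓞 (maximalRealSubfield K)) : maximalRealSubfield K)) := by
  set θ₀ : K := (1 + 2 * ζ ^ 11) * (1 + 2 * (ζ ^ 3 + (ζ ^ 3) ^ 3 + (ζ ^ 3) ^ 4 + (ζ ^ 3) ^ 5 + (ζ ^ 3) ^ 9))
    with hθ₀
  have hmem : θ₀ ∈ maximalRealSubfield K :=
    (IsCMField.complexConj_eq_self_iff K θ₀).mp (complexConj_sqrtThirtyThree hζ)
  set θ : maximalRealSubfield K := ⟨θ₀, hmem⟩ with hθ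
  have hD : θ ^ 2 = ((33 : ℕ) : maximalRealSubfield K) := by
    apply Subtype.ext
    push_cast
    exact sq_sqrtThirtyThree hζ
  have hsq : ¬ IsSquare (33 : ℕ) := by
    rintro ⟨r, hr⟩
    have hr5 : r ≤ 6 := by nlinarith
    interval_cases r <;> omega
  rw [norm_units_eq_one_of_sq_eq hD hsq Nat.prime_three (by norm_num) (by norm_num) (by norm_num) v]
  norm_num

/-- **THEOREM L (i) at `M = 44`, proved**: every unit of `𝓞(ℚ(ζ₄₄)⁺)` has positive norm (`ℚ(ζ₄₄)⁺ ∋ √11`,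
`11 ≡ 3 (mod 4)`).
research route conditional on HC_CM; not a corollary; Q11.4-sentence-2 already refuted in dim ≥ 3. [folklore] -/
theorem norm_realUnits_pos_fortyFour [IsCyclotomicExtension {44} ℚ K] {ζ : K} (hζ : IsPrimitiveRoot ζ 44)
    (v : (𝓞 (maximalRealSubfield K))ˣ) :
    0 < Algebra.norm ℚ (((v : 𝓞 (maximalRealSubfield K)) : maximalRealSubfield K)) := by
  set θ₀ : K := ζ ^ 11 * (1 + 2 * (ζ ^ 4 + (ζ ^ 4) ^ 3 + (ζ ^ 4) ^ 4 + (ζ ^ 4) ^ 5 + (ζ ^ 4) ^ 9)) with hθ₀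
  have hmem : θ₀ ∈ maximalRealSubfield K :=
    (IsCMField.complexConj_eq_self_iff K θ₀).mp (complexConj_sqrtEleven hζ)
  set θ : maximalRealSubfield K := ⟨θ₀, hmem⟩ with hθ
  have hD : θ ^ 2 = ((11 : ℕ) : maximalRealSubfield K) := by
    apply Subtype.ext
    push_cast
    exact sq_sqrtEleven hζ
  have hsq : ¬ IsSquare (11 : ℕ) := by
    rintro ⟨r, hr⟩
    have hr5 : r ≤ 4 := by nlinarith
    interval_cases r <;> omega
  rw [norm_units_eq_one_of_sq_eq hD hsq (by norm_num : Nat.Prime 11) (by norm_num) (by norm_num)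
    (by norm_num) v]
  norm_num

/-! ### §2 The two census rows, hypothesis-free -/

open scoped Classical in
/-- **CENSUS ROW `(ℚ(ζ₃₃), ℚ(√−11))` — UNCONDITIONAL: NO `ι`-compatible principal polarisation on
`ℂ^Φ/Φ(ℤ[ζ₃₃])`** for any CM type `Φ` of `ℚ(ζ₃₃)` balanced for
`N_{√−11} = {2, 7, 8, 10, 13, 17, 19, 28, 29, 32}` (the units `t` with `t mod 11 ∈ {2,6,7,8,10}`; `ℚ(√−11)`-signature
`(5,5)`; `n₋ = #{2,7,8,10,13} = 5` odd): no simple CM Weil tenfold with `End = ℤ[ζ₃₃]` and `ℚ(√−11)`-balanced type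
is principally polarisable (census b01.23 (D)).
research route conditional on HC_CM; not a corollary; Q11.4-sentence-2 already refuted in dim ≥ 3. [cite: Shimura1998, §14.3 Prop. 5, p. 104] -/
theorem not_exists_principal_thirtyThree [IsCyclotomicExtension {33} ℚ K] {ζ : K} (hζ : IsPrimitiveRoot ζ 33)
    (Φ : CMType K)
    (hbal : 2 * ((Finset.univ.filter fun t : ZMod 33 =>
        ∃ σ ∈ Φ.1, σ ζ = ((ZMod.toCircle t : Circle) : ℂ)) ∩
        ({2, 7, 8, 10, 13, 17, 19, 28, 29, 32} : Finset (ZMod 33))).card =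
      (Finset.univ.filter fun t : ZMod 33 => ∃ σ ∈ Φ.1, σ ζ = ((ZMod.toCircle t : Circle) : ℂ)).card) :
    ¬ ∃ ζ' : K, IsCMField.complexConj K ζ' = -ζ' ∧ (∀ φ : Φ.1, 0 < (φ.1 ζ').im) ∧
        CMTypeLattice.IsOfType (1 : (FractionalIdeal (𝓞 K)⁰ K)ˣ) ζ' ⊤ := by
  have hK : IsCMTypeSet 33 ({2, 7, 8, 10, 13, 17, 19, 28, 29, 32} : Finset (ZMod 33)) := by decide
  have hg : Nat.totient 33 = 2 * (9 + 1) := by decide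
  have hodd : Odd (({2, 7, 8, 10, 13, 17, 19, 28, 29, 32} : Finset (ZMod 33)).filter
      fun t : ZMod 33 => 2 * t.val < 33).card := by
    decide
  exact not_exists_principal_of_norm_pos_of_odd hζ hg Φ hK hbal hodd (norm_realUnits_pos_thirtyThree hζ)

open scoped Classical in
/-- **CENSUS ROW `(ℚ(ζ₄₄), ℚ(√−11))` — UNCONDITIONAL: NO `ι`-compatible principal polarisation on
`ℂ^Φ/Φ(ℤ[ζ₄₄])`** for any CM type `Φ` of `ℚ(ζ₄₄)` balanced for
`N_{√−11} = {7, 13, 17, 19, 21, 29, 35, 39, 41, 43}` (`t mod 11 ∈ {2,6,7,8,10}`; `n₋ = #{7,13,17,19,21} = 5` odd): no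
simple CM Weil tenfold with `End = ℤ[ζ₄₄]` and `ℚ(√−11)`-balanced type is principally polarisable (census b01.23 (D)).
research route conditional on HC_CM; not a corollary; Q11.4-sentence-2 already refuted in dim ≥ 3. [cite: Shimura1998, §14.3 Prop. 5, p. 104] -/
theorem not_exists_principal_fortyFour [IsCyclotomicExtension {44} ℚ K] {ζ : K} (hζ : IsPrimitiveRoot ζ 44)
    (Φ : CMType K)
    (hbal : 2 * ((Finset.univ.filter fun t : ZMod 44 =>
        ∃ σ ∈ Φ.1, σ ζ = ((ZMod.toCircle t : Circle) : ℂ)) ∩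
        ({7, 13, 17, 19, 21, 29, 35, 39, 41, 43} : Finset (ZMod 44))).card =
      (Finset.univ.filter fun t : ZMod 44 => ∃ σ ∈ Φ.1, σ ζ = ((ZMod.toCircle t : Circle) : ℂ)).card) :
    ¬ ∃ ζ' : K, IsCMField.complexConj K ζ' = -ζ' ∧ (∀ φ : Φ.1, 0 < (φ.1 ζ').im) ∧
        CMTypeLattice.IsOfType (1 : (FractionalIdeal (𝓞 K)⁰ K)ˣ) ζ' ⊤ := by
  have hK : IsCMTypeSet 44 ({7, 13, 17, 19, 21, 29, 35, 39, 41, 43} : Finset (ZMod 44)) := by decide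
  have hg : Nat.totient 44 = 2 * (9 + 1) := by decide
  have hodd : Odd (({7, 13, 17, 19, 21, 29, 35, 39, 41, 43} : Finset (ZMod 44)).filter
      fun t : ZMod 44 => 2 * t.val < 44).card := by
    decide
  exact not_exists_principal_of_norm_pos_of_odd hζ hg Φ hK hbal hodd (norm_realUnits_pos_fortyFour hζ)

end Summit.HodgeConjecture.Ring2WeilCoverage.CyclotomicUnconditionalSqrtNegEleven

end
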